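import Summits.BirchSwinnertonDyer.Rank1Residual.X2.NonsplitBDPValueDisplayPNew
import Summits.BirchSwinnertonDyer.Rank1Residual.X2.NonsplitHalvesOnTreeInt
import Summits.BirchSwinnertonDyer.Rank1Residual.X2.NonsplitCellCNotGVClass
import Summits.BirchSwinnertonDyer.Rank1Residual.X11b.IntSeriesValueRigidityOneSided
import Summits.BirchSwinnertonDyer.Rank1Residual.X11b.RouteR1LogOmega
import Summits.BirchSwinnertonDyer.Rank1Residual.Partition.AnticyclotomicControlJSWEmbAt
import HarnessLib

/-!
# The BDP value at `𝟙` of EVERY ♭-frame at an X2 Heegner datum with `p ≥ 5`, EITHER SIGN, from print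
# — `R1.BDPValueAtOneIntAt` from [cas-split] Thms. 2.10–2.11 (BDP display, `thm210_thm211_bdpDisplay_pNew`)
# + the kernel rescaling `continuousDisplay_pNew_of_bdpDisplay` + the X11b cell's one-sided value
# rigidity across periods (cell `bsd-eis`, seat `bsd-eis-k5-c4`; route `EisensteinPrimes`, crux 4
# `BSDpOnCellC` = stmt-BirchSwinnertonDyer-19034, line b1 v5 `stub_c2` = c2♭ ∧ c2s♭; RULING L11 (O2))

HONEST FRAMING (cell `bsd-eis`): theorems only; nothing booked; X2 stays CONSTRUCTION-SHAPED; no label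
moves; BSD is not proved by any of this.

The value half of crux 4 is typed, at both signs, as a ♭-predicate over `𝓞_{ℂ_p}`-frames:
`NonsplitBDPValueOnTreeInt W p` (k5-c4 g0) / `SplitBDPValueOnTreeInt W p` (cgshw g8) — "every ♭-frame `Q`
at the datum has `Q(𝟙) = u·((1 − a_p p⁻¹)·log_{ω_E} P)²`" (`R1.BDPValueAtOneIntAt`). The PRINTED source at
`p ≥ 5` is SIGN-FREE (`a_p(f)` symbolic in [cas-split] §2): the Literature fact
`Castella2018Exceptional.thm210_thm211_bdpDisplay_pNew` (p435419) and its kernel companion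
`X2.continuousDisplay_pNew_of_bdpDisplay` (p436452) never look at the sign. `X2/NonsplitCellCClassIntPNew.lean`
(p436961) used them INLINE on the non-split road; this file isolates the sign-free POINTWISE statement
both roads need, so that the split road's consumer (cgshw, RULINGS L11/L12 (iii)) is a three-line call:

* **`bdpValueAtOneIntAt_of_bdpDisplay_pNew`** — at an X2 datum (`p ≠ 2` multiplicative, EITHER sign)
  with `5 ≤ p`: `W` of conductor `N`, `K` imaginary quadratic with ODD `d_K` and the Heegner hypothesis
  for `N`, a degree-one prime `𝔭 ∣ p` with an embedding datum `ι′` inducing it, the anticyclotomic `κ`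
  with generator `γ`, a parametrisation datum `Dt` with `p ∤ Dt.c`, a Heegner datum `H`, the Heegner
  point `P ∈ E(K)` read through `w₀.embedding` and of infinite order — EVERY ♭-frame `Q` of
  `(ι′, 𝔭, κ, γ, Dt.f)` with non-zero virtual periods has the BDP value at `𝟙`:
  `R1.BDPValueAtOneIntAt W p (embAt K p 𝔭 …) P Q (a_p(E))`. Inputs: the fact (`hCS`); proof:
  `continuousDisplay_pNew_of_bdpDisplay` gives the continuous-function display, `(1 − a_p p⁻¹)·log P ≠ 0`
  (`a_p = ±1`, `P` of infinite order), and `X11b.intSeries_constantCoeff_eq_of_isBDPLFunctionInt_of_continuousValues`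
  transfers the value to `Q`.

Scope: what print does NOT give (and this file does not claim): the value at `p = 3 ‖ N` (no printed
theorem; LZZ18 modulo N1–N3), at EVEN `d_K` (BDP Thm. 4.6 is printed for odd `d_K`), or for a newform
other than the one of the parametrisation datum — which is why the ♭-PREDICATES (quantifying over all
such `K`, `f`) are not asserted here; the roads use the pointwise statement at their own admissible `K`
(odd `d_K < −4`, Hoffstein–Luo). CONDITIONAL on the cited fact; nothing booked; no label change.

References: [Castella2018Exceptional] Thms. 2.10–2.11; [BertoliniDarmonPrasanna2013] Thm. 4.6, (5.1.11),
Thm. 5.5, §5.2; [Castella2018] Thm. 3.1–3.2; [CastellaHsieh2018] §3.3.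
-/

set_option autoImplicit false

noncomputable section

open scoped Classical MatrixGroups ModularForm Topology

open Filter CongruenceSubgroup WeierstrassCurve NumberField IsDedekindDomain Field PowerSeries
  Literature.NumberTheory.EllipticCurves Literature.NumberTheory.EllipticCurves.GreenbergSelmer
  Literature.NumberTheory.EllipticCurves.ModularForms Literature.NumberTheory.QuadraticFields
  Literature.NumberTheory.EllipticCurves.Rank1Residual
  Literature.NumberTheory.EllipticCurves.Rank1Residual.Typed
  Literature.NumberTheory.EllipticCurves.Castella2018
  Literature.NumberTheory.EllipticCurves.Castella2018Exceptional
  Literature.NumberTheory.GaloisRepresentations Literature.NumberTheory.GaloisCohomology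
  Literature.NumberTheory.Automorphic
  Summit.BirchSwinnertonDyer.Rank1Residual.X11b.AcSelmer
  Summit.BirchSwinnertonDyer.Rank1Residual.X11b.Halves
  Summit.BirchSwinnertonDyer.Rank1Residual.X11b

namespace Summit.BirchSwinnertonDyer.Rank1Residual.X2

/-- **The BDP value at `𝟙` of every ♭-frame at an X2 Heegner datum, `p ≥ 5`, EITHER SIGN, from
[cas-split] Thms. 2.10–2.11 in BDP's display.** At a multiplicative `p ≠ 2` with `5 ≤ p`, `W` of
conductor `N`, `K` imaginary quadratic with odd `d_K` satisfying the Heegner hypothesis for `N`, a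
degree-one `𝔭 ∣ p` with embedding datum `ι′`, the anticyclotomic `κ` with generator `γ`, `Dt` with
`p ∤ Dt.c`, a Heegner datum `H`, `P ∈ E(K)` THE Heegner point (read through `w₀.embedding`) of infinite
order: every ♭-frame `Q` (`R1.IsBDPLFunctionInt p ι′ 𝔭 κ γ Dt.f Ω_K Ω_p Q`, `Ω_K ≠ 0`, `Ω_p ≠ 0`) has
`R1.BDPValueAtOneIntAt W p (embAt K p 𝔭 …) P Q (a_p(E))`, i.e. `Q(𝟙) = u·((1 − a_p p⁻¹)·log_{ω_E} P)²`,
`‖u‖ = 1`. Proof: `continuousDisplay_pNew_of_bdpDisplay` (the fact in BDP's display ⟹ the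
continuous-function display with virtual periods), `c = u′·((1 − a_p p⁻¹)·log P)² ≠ 0` (`p ∤ a_p = ±1`,
`X11b.R1.not_dvd_lFunction_of_mult`; `log_{ω_E} P ≠ 0`, `X11b.R1.logOmega_ne_zero`), and one-sided value
rigidity across periods (`X11b.intSeries_constantCoeff_eq_of_isBDPLFunctionInt_of_continuousValues`).
CONDITIONAL on the cited fact; nothing booked; X2 CONSTRUCTION-SHAPED; no label change.
[cite: Castella2018Exceptional, Thm. 2.10 and Thm. 2.11 (arXiv:1507.04260 pp. 13–14)]
[cite: BertoliniDarmonPrasanna2013, §5.2 (Prop. 5.10, (5.2.3)–(5.2.4))]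
[cite: Castella2018, Thm. 3.1–3.2 (arXiv:1704.06608 p. 9)] [cite: CastellaHsieh2018, §3.3] -/
theorem bdpValueAtOneIntAt_of_bdpDisplay_pNew (hCS : thm210_thm211_bdpDisplay_pNew)
    {p : ℕ} [Fact p.Prime] (ι' : PadicAlgCl p ≃+* ℂ) (W : WeierstrassCurve ℚ) [W.IsElliptic]
    [W.IsGloballyMinimal] (K : Type) [Field K] [NumberField K] (𝔭 : HeightOneSpectrum (𝓞 K))
    (κ : ZpExtension K p) (γ : absoluteGaloisGroup K) {N : ℕ} [NeZero N]
    (Dt : ModularParametrizationData W N) (H : HeegnerDatum N (NumberField.discr K))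
    (w₀ : InfinitePlace K) (P : (W.baseChange K).toAffine.Point)
    (hp5 : 5 ≤ p) (hp2 : p ≠ 2) (hmult : Mult W p) (hN : W.conductorNorm ℤ = N)
    (hK : IsImaginaryQuadratic K) (hodd : Odd (NumberField.discr K))
    (hHN : SatisfiesHeegnerHypothesis N K)
    (h𝔭 : ((p : ℕ) : 𝓞 K) ∈ 𝔭.asIdeal) (he : 𝔭.asIdeal.ramificationIdx (𝓞 ℚ) = 1)
    (hf : 𝔭.asIdeal.inertiaDeg (𝓞 ℚ) = 1)
    (hι' : ∀ (w : InfinitePlace K) (k : 𝓞 K), k ∈ 𝔭.asIdeal ↔ ‖ι'.symm (w.embedding (k : K))‖ < 1)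
    (hκ : κ.IsAnticyclotomic) (hγ : κ.IsTopGenerator γ) (hcM : ¬ (p : ℤ) ∣ Dt.c)
    (hP : WeierstrassCurve.Affine.Point.map w₀.embedding.toRatAlgHom P = heegnerPointComplex Dt H)
    (hPinf : ¬ IsOfFinAddOrder P)
    {ΩK : ℂ} {Ωp : ℂ_[p]} {Q : PowerSeries 𝓞_ℂ_[p]} (hΩK : ΩK ≠ 0) (hΩp : Ωp ≠ 0)
    (hQ : R1.IsBDPLFunctionInt p ι' 𝔭 κ γ Dt.f ΩK Ωp Q) :
    R1.BDPValueAtOneIntAt W p (embAt K p 𝔭 h𝔭 he hf) P Q (W.LFunction p) := by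
  have hp : p.Prime := Fact.out
  have hpN : p ∣ N := hN ▸ X11b.dvd_conductorNorm_of_mult (W := W) hmult
  have hp2N : ¬ p ^ 2 ∣ N := hN ▸ not_sq_dvd_conductorNorm_of_mult W p hmult
  -- the continuous-function display from print, at this datum
  have hemb : ∀ k : 𝓞 K, k ∈ 𝔭.asIdeal ↔ ‖embAt K p 𝔭 h𝔭 he hf (k : K)‖ < 1 :=
    mem_asIdeal_iff_norm_embAt_lt_one 𝔭 h𝔭 he hf
  obtain ⟨ΩK₀, Ωp₀, u₀, hΩK₀, hΩp₀, hu₀, hcont⟩ := continuousDisplay_pNew_of_bdpDisplay hCS ι' W K 𝔭 κ γ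
    Dt H w₀ (embAt K p 𝔭 h𝔭 he hf) P hp5 hN hpN hp2N hK hodd (hHN p hp hpN) h𝔭 hι' hHN hκ hγ hcM hP hemb
  -- the limit is non-zero: `p ∤ a_p = ±1` and `log_{ω_E} P ≠ 0`
  have ha : ¬ (p : ℤ) ∣ W.LFunction p := X11b.R1.not_dvd_lFunction_of_mult Dt.isNewformOf hmult
  have hX : algebraMap ℚ_[p] ℂ_[p] (((1 : ℚ_[p]) - ((W.LFunction p : ℤ) : ℚ_[p]) * (p : ℚ_[p])⁻¹) *
      padicLogOmega W p (embAt K p 𝔭 h𝔭 he hf) P) ≠ 0 := by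
    rw [map_ne_zero_iff _ (algebraMap ℚ_[p] ℂ_[p]).injective]
    refine mul_ne_zero ?_ ?_
    · intro h0
      have h := X11b.R1.norm_one_sub_div_eq p ha
      rw [h0, norm_zero] at h
      have hp0 : (0 : ℝ) < p := by exact_mod_cast hp.pos
      exact absurd h (ne_of_lt hp0)
    · rw [← X11b.R1.logOmega_eq_padicLogOmega]
      exact X11b.R1.logOmega_ne_zero W p _ hPinf
  have hu₀0 : u₀ ≠ 0 := fun h0 ↦ by rw [h0, norm_zero] at hu₀; exact zero_ne_one hu₀
  have hc0 : u₀ * (algebraMap ℚ_[p] ℂ_[p] (((1 : ℚ_[p]) - ((W.LFunction p : ℤ) : ℚ_[p]) *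
      (p : ℚ_[p])⁻¹) * padicLogOmega W p (embAt K p 𝔭 h𝔭 he hf) P)) ^ 2 ≠ 0 :=
    mul_ne_zero hu₀0 (pow_ne_zero _ hX)
  -- one-sided value rigidity across periods
  have heq := X11b.intSeries_constantCoeff_eq_of_isBDPLFunctionInt_of_continuousValues hp2 hK hκ hγ
    hΩK₀ hΩK hΩp₀ hΩp hcont hc0 hQ
  refine ⟨u₀, hu₀, ?_⟩
  rw [X11b.R1.logOmega_eq_padicLogOmega, ← heq]
  exact X11b.R1.intSeries_hasValueAt_zero p Q

end Summit.BirchSwinnertonDyer.Rank1Residual.X2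

end
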